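import Summits.Parity.GeneralizedHardyLittlewood.Theorems.BeyondDiagonalBeatsQuarter.OffDiagCleanScales
import Summits.Parity.GeneralizedHardyLittlewood.Theorems.BeyondDiagonalBeatsQuarter.OffDiagGoodPrimesDense
import HarnessLib

/-!
# Route `PrimeLevelFamEdge`, crux K_B (stmt-Parity-20343), line `diagonal_kernel_split` rev 4, plan Ω,
# sub-line **Ω-h (v1) — APPROXIMATION TRANSFER for the heart: a block bound at clean scales for ANY
# `ε·ms`-approximant `H` of the mollified off-diagonal gives `stub_offDiagBelowSlack_io` VERBATIM**

The entry point of record (`PeterssonSplit.offDiagBelowSlack_io_of_blockAtCleanScales_pointwise`, p634449) asks at every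
clean scale `N` for `(goodPrimes Δ′ N).Nonempty` AND the block inequality for `offDiagMollified`. Plan Ω never bounds
`offDiagMollified` itself but a FINITE approximant of it — the head `Σ_{r ≤ q^{A₀}}` of the layer series
(`OffDiagLayersMollified.offDiagMollified_eq_head_add_tail`, r-tail `≤ ε·ms` — Ω-d3/W-b), further truncated in boxes and
dual lengths (Ω-d4/d5, L2–L3 of OMEGA-BLUEPRINT). This file turns that practice into one lemma, with the approximant
abstract:

* **`offDiagBelowSlack_io_of_approxBlockAtCleanScales`** — for ANY `H : ℝ → ℕ → ℝ` with
  `|offDiagMollified Δ′ q − H Δ′ q| ≤ ε·mainScaleReal Δ′ q` for every `ε > 0`, eventually in prime `q` (each `Δ′ ∈ (1,2)`),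
  a block bound `Σ_{q ∈ goodPrimes Δ′ N} H Δ′ q ≤ U·Σ_q ms` with `U < slack(Δ′)` at clean scales (the quantifier shell of
  p634449, `c′₀` first, WITHOUT the non-emptiness conjunct) implies the registered heart verbatim — the slack lost to the
  approximation is absorbed (`U ↦ (U + slack)/2`), and non-emptiness of the blocks is now a theorem
  (`OffDiag.goodPrimes_nonempty_eventually`, p637809);
* `sum_le_of_approx` — the bookkeeping step `Σ F ≤ Σ H + ε Σ ms` on a block all of whose members are `≥ q₀`.

Pure logic over the tree's objects; theorems only; standard axioms. Helper toward `stub_offDiagBelowSlack_io`; closes nothing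
(the block bound for a concrete `H` is plan Ω's open content, LIVE-Ω).
«The programme SEARCHES and TYPES; no claim about Landau–Siegel zeros, Theorems 1–2 of arXiv:2211.02515 or
a repaired Margin232 until a kernel theorem says so.»
-/

noncomputable section

open Finset Polynomial
open scoped Real

namespace Summit.Parity.GeneralizedHardyLittlewood.Theorems.BeyondDiagonalBeatsQuarter.OffDiag

open Literature.NumberTheory.LFunctions Literature.NumberTheory.LFunctions.KMV2000
open PeterssonSplit (offDiag offDiagMollified offDiagBelowSlack_io_of_blockAtCleanScales_pointwise)

/-- Bookkeeping: if `|F q − H q| ≤ ε·m q` for all `q ≥ q₀` prime, and every member of the block `S` is a prime `≥ q₀`, then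
`Σ_{q∈S} F q ≤ Σ_{q∈S} H q + ε·Σ_{q∈S} m q`. [folklore] -/
theorem sum_le_of_approx {F H m : ℕ → ℝ} {ε : ℝ} {q₀ : ℕ} {S : Finset ℕ}
    (happ : ∀ q : ℕ, q₀ ≤ q → q.Prime → |F q - H q| ≤ ε * m q)
    (hS : ∀ q ∈ S, q₀ ≤ q ∧ q.Prime) :
    ∑ q ∈ S, F q ≤ ∑ q ∈ S, H q + ε * ∑ q ∈ S, m q := by
  rw [Finset.mul_sum, ← Finset.sum_add_distrib]
  refine Finset.sum_le_sum fun q hq ↦ ?_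
  obtain ⟨h1, h2⟩ := hS q hq
  have h := (abs_le.mp (happ q h1 h2)).2
  linarith

/-- Members of `goodPrimes Δ′ N` are primes `≥ N + 1`. [cite: KowalskiMichelVanderKam2000, §2 p. 7 (M ∉ ℤ)] -/
theorem goodPrimes_ge_and_prime {Δ' : ℝ} {N q : ℕ} (hq : q ∈ goodPrimes Δ' N) : N + 1 ≤ q ∧ q.Prime := by
  obtain ⟨h1, -, hp, -⟩ := mem_goodPrimes_iff.mp hq
  exact ⟨h1, hp⟩

/-- **Ω-h (v1): approximation transfer for the heart.** Let `H : ℝ → ℕ → ℝ` approximate the mollified off-diagonal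
to every precision `ε·ms` eventually in prime `q` (for each `Δ′ ∈ (1,2)`). Then a block bound for `H` at clean scales,
in the quantifier order of `offDiagBelowSlack_io_of_blockAtCleanScales_pointwise` (p634449) but without the non-emptiness
conjunct, implies the rev-4 heart `stub_offDiagBelowSlack_io` VERBATIM.
[cite: MontgomeryVaughan2007, Cor. 11.10 (Page); KowalskiMichelVanderKam2000, §6 p. 19 — derivation] -/
theorem offDiagBelowSlack_io_of_approxBlockAtCleanScales (H : ℝ → ℕ → ℝ)
    (hT : ∀ Δ' : ℝ, 1 < Δ' → Δ' < 2 → ∀ ε : ℝ, 0 < ε → ∃ q₀ : ℕ, ∀ q : ℕ, q₀ ≤ q → q.Prime →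
      |offDiagMollified Δ' q - H Δ' q| ≤ ε * mainScaleReal Δ' q)
    (hΩ : ∀ c₀' : ℝ, 0 < c₀' → ∃ b : ℝ, 1 < b ∧ ∀ Δ' : ℝ, 1 < Δ' → Δ' < b →
      ∃ U : ℝ, U < 4 * (Δ' - 1) / Δ' ∧ ∃ a₀ : ℝ, 0 < a₀ ∧ ∃ η' : ℝ, 0 < η' ∧ η' < c₀' / a₀ ∧
        ∃ N₀ : ℕ, ∀ N : ℕ, N₀ ≤ N → CleanScale a₀ η' N →
          ∑ q ∈ goodPrimes Δ' N, H Δ' q ≤ U * ∑ q ∈ goodPrimes Δ' N, mainScaleReal Δ' q) :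
    ∃ b : ℝ, 1 < b ∧ ∀ Δ' : ℝ, 1 < Δ' → Δ' < b → ∃ U : ℝ, U < 4 * (Δ' - 1) / Δ' ∧
      ∀ q₀ : ℕ, ∃ q : ℕ, ∃ _ : NeZero q, q₀ ≤ q ∧ q.Prime ∧
        (∀ n : ℕ, (n : ℝ) ≠ qhat q ^ Δ') ∧
          -(∑ l ∈ Icc 1 ⌊qhat q ^ Δ'⌋₊, ∑ m ∈ Icc 1 ⌊qhat q ^ Δ'⌋₊,
              ((mollifierCoeff (X ^ 2) (qhat q ^ Δ') l * mollifierCoeff (X ^ 2) (qhat q ^ Δ') m : ℝ) : ℂ) *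
                offDiag q l m).re ≤ U * mainScaleReal Δ' q := by
  refine offDiagBelowSlack_io_of_blockAtCleanScales_pointwise fun c₀' hc₀' ↦ ?_
  obtain ⟨b, hb, Hb⟩ := hΩ c₀' hc₀'
  -- shrink the window to `(1, min b 2)` so that `Δ′ < 2` is available
  refine ⟨min b 2, lt_min hb (by norm_num), fun Δ' h1 h2 ↦ ?_⟩
  have h2b : Δ' < b := lt_of_lt_of_le h2 (min_le_left _ _)
  have h22 : Δ' < 2 := lt_of_lt_of_le h2 (min_le_right _ _)
  obtain ⟨U, hU, a₀, ha₀, η', hη', hη'c, N₀, HN⟩ := Hb Δ' h1 h2b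
  -- absorb the approximation loss into the slack
  set ε : ℝ := (4 * (Δ' - 1) / Δ' - U) / 2 with hε
  have hεpos : 0 < ε := by rw [hε]; linarith
  obtain ⟨q₀, hq₀⟩ := hT Δ' h1 h22 ε hεpos
  obtain ⟨N₁, hN₁⟩ := goodPrimes_nonempty_eventually (lt_trans zero_lt_one h1) h22
  refine ⟨U + ε, by rw [hε]; linarith, a₀, ha₀, η', hη', hη'c, max N₀ (max N₁ q₀), fun N hN hclean ↦ ?_⟩
  have hN0 : N₀ ≤ N := le_trans (le_max_left _ _) hN
  have hN1 : N₁ ≤ N := le_trans (le_trans (le_max_left _ _) (le_max_right _ _)) hN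
  have hNq : q₀ ≤ N := le_trans (le_trans (le_max_right _ _) (le_max_right _ _)) hN
  refine ⟨hN₁ N hN1, ?_⟩
  have hblock := HN N hN0 hclean
  have happrox := sum_le_of_approx (S := goodPrimes Δ' N) (F := fun q ↦ offDiagMollified Δ' q)
    (H := fun q ↦ H Δ' q) (m := fun q ↦ mainScaleReal Δ' q) hq₀
    (fun q hq ↦ by
      obtain ⟨hge, hp⟩ := goodPrimes_ge_and_prime hq
      exact ⟨by omega, hp⟩)
  have hms : 0 ≤ ∑ q ∈ goodPrimes Δ' N, mainScaleReal Δ' q :=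
    Finset.sum_nonneg fun q _ ↦ mainScaleReal_nonneg Δ' q
  calc ∑ q ∈ goodPrimes Δ' N, offDiagMollified Δ' q
      ≤ ∑ q ∈ goodPrimes Δ' N, H Δ' q + ε * ∑ q ∈ goodPrimes Δ' N, mainScaleReal Δ' q := happrox
    _ ≤ U * ∑ q ∈ goodPrimes Δ' N, mainScaleReal Δ' q + ε * ∑ q ∈ goodPrimes Δ' N, mainScaleReal Δ' q := by
        linarith
    _ = (U + ε) * ∑ q ∈ goodPrimes Δ' N, mainScaleReal Δ' q := by ring

/-- The same transfer in the `a₀`-first quantifier order of `offDiagBelowSlack_io_of_blockAtCleanScales` (p634449's first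
entry point): stated for completeness, proof by the pointwise version is not available in that order, so this lemma repeats
the argument with `cleanScales_io`. [cite: MontgomeryVaughan2007, Cor. 11.10 (Page); KowalskiMichelVanderKam2000, §6 p. 19 — derivation] -/
theorem offDiagBelowSlack_io_of_approxBlockAtCleanScales_a₀ (H : ℝ → ℕ → ℝ)
    (hT : ∀ Δ' : ℝ, 1 < Δ' → Δ' < 2 → ∀ ε : ℝ, 0 < ε → ∃ q₀ : ℕ, ∀ q : ℕ, q₀ ≤ q → q.Prime →
      |offDiagMollified Δ' q - H Δ' q| ≤ ε * mainScaleReal Δ' q)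
    (hΩ : ∃ a₀ : ℝ, 0 < a₀ ∧ ∀ η₀ : ℝ, 0 < η₀ → ∃ b : ℝ, 1 < b ∧ ∀ Δ' : ℝ, 1 < Δ' → Δ' < b →
      ∃ U : ℝ, U < 4 * (Δ' - 1) / Δ' ∧ ∃ η' : ℝ, 0 < η' ∧ η' < η₀ ∧ ∃ N₀ : ℕ, ∀ N : ℕ, N₀ ≤ N →
        CleanScale a₀ η' N →
          ∑ q ∈ goodPrimes Δ' N, H Δ' q ≤ U * ∑ q ∈ goodPrimes Δ' N, mainScaleReal Δ' q) :
    ∃ b : ℝ, 1 < b ∧ ∀ Δ' : ℝ, 1 < Δ' → Δ' < b → ∃ U : ℝ, U < 4 * (Δ' - 1) / Δ' ∧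
      ∀ q₀ : ℕ, ∃ q : ℕ, ∃ _ : NeZero q, q₀ ≤ q ∧ q.Prime ∧
        (∀ n : ℕ, (n : ℝ) ≠ qhat q ^ Δ') ∧
          -(∑ l ∈ Icc 1 ⌊qhat q ^ Δ'⌋₊, ∑ m ∈ Icc 1 ⌊qhat q ^ Δ'⌋₊,
              ((mollifierCoeff (X ^ 2) (qhat q ^ Δ') l * mollifierCoeff (X ^ 2) (qhat q ^ Δ') m : ℝ) : ℂ) *
                offDiag q l m).re ≤ U * mainScaleReal Δ' q := by
  refine PeterssonSplit.offDiagBelowSlack_io_of_blockAtCleanScales ?_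
  obtain ⟨a₀, ha₀, Ha⟩ := hΩ
  refine ⟨a₀, ha₀, fun η₀ hη₀ ↦ ?_⟩
  obtain ⟨b, hb, Hb⟩ := Ha η₀ hη₀
  refine ⟨min b 2, lt_min hb (by norm_num), fun Δ' h1 h2 ↦ ?_⟩
  have h2b : Δ' < b := lt_of_lt_of_le h2 (min_le_left _ _)
  have h22 : Δ' < 2 := lt_of_lt_of_le h2 (min_le_right _ _)
  obtain ⟨U, hU, η', hη', hη'c, N₀, HN⟩ := Hb Δ' h1 h2b
  set ε : ℝ := (4 * (Δ' - 1) / Δ' - U) / 2 with hε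
  have hεpos : 0 < ε := by rw [hε]; linarith
  obtain ⟨q₀, hq₀⟩ := hT Δ' h1 h22 ε hεpos
  obtain ⟨N₁, hN₁⟩ := goodPrimes_nonempty_eventually (lt_trans zero_lt_one h1) h22
  refine ⟨U + ε, by rw [hε]; linarith, η', hη', hη'c, max N₀ (max N₁ q₀), fun N hN hclean ↦ ?_⟩
  have hN0 : N₀ ≤ N := le_trans (le_max_left _ _) hN
  have hN1 : N₁ ≤ N := le_trans (le_trans (le_max_left _ _) (le_max_right _ _)) hN
  have hNq : q₀ ≤ N := le_trans (le_trans (le_max_right _ _) (le_max_right _ _)) hN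
  refine ⟨hN₁ N hN1, ?_⟩
  have hblock := HN N hN0 hclean
  have happrox := sum_le_of_approx (S := goodPrimes Δ' N) (F := fun q ↦ offDiagMollified Δ' q)
    (H := fun q ↦ H Δ' q) (m := fun q ↦ mainScaleReal Δ' q) hq₀
    (fun q hq ↦ by
      obtain ⟨hge, hp⟩ := goodPrimes_ge_and_prime hq
      exact ⟨by omega, hp⟩)
  calc ∑ q ∈ goodPrimes Δ' N, offDiagMollified Δ' q
      ≤ ∑ q ∈ goodPrimes Δ' N, H Δ' q + ε * ∑ q ∈ goodPrimes Δ' N, mainScaleReal Δ' q := happrox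
    _ ≤ U * ∑ q ∈ goodPrimes Δ' N, mainScaleReal Δ' q + ε * ∑ q ∈ goodPrimes Δ' N, mainScaleReal Δ' q := by
        linarith
    _ = (U + ε) * ∑ q ∈ goodPrimes Δ' N, mainScaleReal Δ' q := by ring

end Summit.Parity.GeneralizedHardyLittlewood.Theorems.BeyondDiagonalBeatsQuarter.OffDiag
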